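import Summits.Ventures.PercRepro.Night2LocalD2R14SixFar

/-!
# PercRepro — the six-element columns of R1₄ with one far preimage, part A (night-2, gen 16)

At a shadow set `S` of the coloop cell with a far preimage `B₀` (pair set `X₀ = S ∖ B₀ = {a, b}`, `G ∖ S ⊆ cl B₀`;
proofs/NIGHT-2-k1.md §7.0 (U2)):

* **`r14CovPre_eq_empty_of_far`** (any `|S|`): there is no covering preimage with `|G ∖ cl B| ≥ 2` — a coloop `z` of `S`
  in `B₀` puts `G ∖ (S ∖ z) ⊆ (cl B₀) ∖ {y}` of rank `3`, and a point of `X₀` is not a coloop of `S` (`B₀ ∪ {b}` has rank `5`);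
* `card_pairPre_le_seven_of_far` (`|S| = 6`): at most `7` pair preimages (every pair set meets `X₀`);
* the spread of a basis `S ∖ {x, y}` (`|S| = 6`): `r14Spread_eq_sum_six` writes the spread part as a sum over `x ∈ S ∖ {y}`
  of `(σ⁺(S ∖ {x, y}) − 3/5)⁺ / |cl B ∖ B|`, with `|cl B ∖ B| ≥ |G ∖ S| + 1`; with a far preimage a basis `S ∖ {x, y}`,
  `x ∈ B₀`, does not spread (`spread_eq_zero_of_mem_far`).
-/

namespace PercRepro.Shadow

open Finset PerFlat ThmH

variable {α : Type*} [DecidableEq α] {M : Matroid α} [M.Finite]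

open scoped Classical in
/-- **With a far preimage there is no covering preimage with `|G ∖ cl B| ≥ 2`.** -/
theorem r14CovPre_eq_empty_of_far {G : Finset α} (hG : G ∈ flatsQ M (4 + 1)) (hd : (gr M \ G).card = 2)
    {y : α} (hyG : y ∈ G) (hyc : y ∉ clF M (G.erase y)) {S B₀ : Finset α} (h₀ : B₀ ∈ opFarPre M G S) :
    r14CovPre M G S = ∅ := by
  have hGg : G ⊆ gr M := (mem_flatsQ.1 hG).1
  have hB₀m := (mem_opFarPre.1 h₀).1
  have hU₀ : B₀ ∈ Uq M (4 + 2) 4 := (mem_membersIn.1 hB₀m).1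
  have hy₀ := mem_of_mem_opFarPre hG hyG hyc h₀
  have hX₀ : S \ B₀ = G \ clF M B₀ := sdiff_eq_of_mem_opFarPre h₀
  have hB₀S : B₀ ⊆ S := subset_of_mem_opFarPre h₀
  rw [Finset.eq_empty_iff_forall_notMem]
  intro B hB
  obtain ⟨z, hzS, hzy, rfl, hz, hyB⟩ := exists_coloop_of_mem_r14CovPre hG hyG hyc hB
  have hBm : S.erase z ∈ membersIn M (Uq M (4 + 2) 4) G := by
    unfold r14CovPre at hB
    exact (mem_coverPreimages.1 (Finset.mem_filter.1 hB).1).1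
  have hBU : S.erase z ∈ Uq M (4 + 2) 4 := (mem_membersIn.1 hBm).1
  by_cases hzB₀ : z ∈ B₀
  · -- `G ∖ (S ∖ z) ⊆ (cl B₀) ∖ {y}`, of rank `3`
    have h3 := rkN_clF_erase_eq_three hG hyG hyc hB₀m hy₀
    have hsub : G \ S.erase z ⊆ (clF M B₀).erase y := by
      intro t ht
      rw [Finset.mem_sdiff, Finset.mem_erase, not_and] at ht
      rw [Finset.mem_erase]
      by_cases htS : t ∈ S
      · have htz : t = z := by
          by_contra h
          exact ht.2 h htS
        subst htz
        exact ⟨hzy, subset_clF hU₀ hzB₀⟩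
      · exact ⟨fun h => htS (h ▸ hB₀S hy₀), sdiff_subset_clF_of_mem_opFarPre h₀ (Finset.mem_sdiff.2 ⟨ht.1, htS⟩)⟩
    have h6 := rkN_sdiff_eq_of_mem_Uq hBU
    have h1 : gr M \ S.erase z ⊆ (G \ S.erase z) ∪ (gr M \ G) := by
      intro t ht
      rw [Finset.mem_sdiff] at ht
      rw [Finset.mem_union, Finset.mem_sdiff, Finset.mem_sdiff]
      by_cases htG : t ∈ G
      · exact Or.inl ⟨htG, ht.2⟩
      · exact Or.inr ⟨ht.1, htG⟩
    have h2 := rkN_mono (M := M) h1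
    have h4 := rkN_union_le_rkN_add_card (M := M) (G \ S.erase z) (gr M \ G)
    have h5 := rkN_mono (M := M) hsub
    omega
  · -- `z ∈ X₀`: `S ∖ z ⊇ B₀ ∪ {z'}` has rank `5`, so `z ∈ cl (S ∖ z)`
    have hzX : z ∈ S \ B₀ := Finset.mem_sdiff.2 ⟨hzS, hzB₀⟩
    have hc : (S \ B₀).card = 2 := by rw [hX₀]; exact (mem_opFarPre.1 h₀).2.1
    obtain ⟨u, v, huv, hXuv⟩ := Finset.card_eq_two.1 hc
    obtain ⟨z', hz'X, hz'z⟩ : ∃ z' ∈ S \ B₀, z' ≠ z := by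
      rw [hXuv] at hzX ⊢
      simp only [Finset.mem_insert, Finset.mem_singleton] at hzX
      rcases hzX with rfl | rfl
      · exact ⟨v, by simp, fun h => huv h.symm⟩
      · exact ⟨u, by simp, huv⟩
    have hz'G : z' ∈ G \ clF M B₀ := by rw [← hX₀]; exact hz'X
    have hr5 := rkN_insert_eq_of_mem_sdiff_clF hG hU₀ hz'G
    have hsub : insert z' B₀ ⊆ S.erase z := by
      intro t ht
      rw [Finset.mem_insert] at ht
      rw [Finset.mem_erase]
      rcases ht with rfl | ht
      · exact ⟨hz'z, (Finset.mem_sdiff.1 hz'X).1⟩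
      · exact ⟨fun h => hzB₀ (h ▸ ht), hB₀S ht⟩
    have hle := rkN_mono (M := M) hsub
    have hSr := rkN_eq_of_mem_Uq hBU
    omega

open scoped Classical in
/-- The pair preimages whose pair set contains a given point `a ∈ S ∖ {y}` number at most `|S| − 2`
(the other point of the pair set determines the preimage). -/
theorem card_pairPre_filter_mem_le {G : Finset α} (hG : G ∈ flatsQ M (4 + 1)) {y : α} (hyG : y ∈ G)
    (hyc : y ∉ clF M (G.erase y)) {S : Finset α} (hS : S ∈ shadowAt M (4 + 2) 4 (Uq M (4 + 2) 4) G) {a : α}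
    (haS : a ∈ S) (hay : a ≠ y) :
    ((pairPre M 4 G S).filter (fun B => a ∈ S \ B)).card + 2 ≤ S.card := by
  have hyS : y ∈ S := mem_of_mem_shadowAt_of_coloop (by rw [rkN_erase_eq_of_coloop hG hyG hyc]) hS
  -- the other point of the pair set lies in `S ∖ {y, a}`
  have hmaps : ∀ B ∈ (pairPre M 4 G S).filter (fun B => a ∈ S \ B), (S \ B).erase a ⊆ (S.erase y).erase a ∧
      ((S \ B).erase a).card = 1 := by
    intro B hB
    rw [Finset.mem_filter] at hB
    refine ⟨?_, by rw [Finset.card_erase_of_mem hB.2, card_sdiff_of_mem_pairPre hB.1]⟩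
    intro t ht
    rw [Finset.mem_erase, Finset.mem_sdiff] at ht
    rw [Finset.mem_erase, Finset.mem_erase]
    exact ⟨ht.1, fun h => (ht.2.2) (h ▸ mem_of_mem_pairPre hG hyG hyc hB.1), ht.2.1⟩
  have hinj : Set.InjOn (fun B => (S \ B).erase a)
      (((pairPre M 4 G S).filter (fun B => a ∈ S \ B)) : Set (Finset α)) := by
    intro B hB B' hB' h
    rw [Finset.mem_coe, Finset.mem_filter] at hB hB'
    by_contra hne
    apply sdiff_ne_of_mem_pairPre hB.1 hB'.1 hne
    have h1 : insert a ((S \ B).erase a) = S \ B := Finset.insert_erase hB.2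
    have h2 : insert a ((S \ B').erase a) = S \ B' := Finset.insert_erase hB'.2
    have h' : (S \ B).erase a = (S \ B').erase a := h
    rw [← h1, ← h2, h']
  have h1 := Finset.card_le_card_of_injOn (fun B => (S \ B).erase a)
    (fun B hB => Finset.mem_powersetCard.2 (hmaps B hB)) hinj
  have h2 : (Finset.powersetCard 1 ((S.erase y).erase a)).card = ((S.erase y).erase a).card := by
    rw [Finset.card_powersetCard, Nat.choose_one_right]
  have h3 : ((S.erase y).erase a).card + 2 = S.card := by
    rw [Finset.card_erase_of_mem (Finset.mem_erase.2 ⟨hay, haS⟩), Finset.card_erase_of_mem hyS]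
    have := Finset.card_pos.2 ⟨y, hyS⟩
    have : 2 ≤ S.card := by
      have := Finset.card_le_card (Finset.insert_subset haS (Finset.singleton_subset_iff.2 hyS))
      rw [Finset.card_pair hay] at this
      exact this
    omega
  omega

open scoped Classical in
/-- **With a far preimage at `|S| = 6` there are at most seven pair preimages** (every pair set meets `X₀`). -/
theorem card_pairPre_le_seven_of_far {G : Finset α} (hG : G ∈ flatsQ M (4 + 1)) (hd : (gr M \ G).card = 2)
    {y : α} (hyG : y ∈ G) (hyc : y ∉ clF M (G.erase y)) {S : Finset α}
    (hS : S ∈ shadowAt M (4 + 2) 4 (Uq M (4 + 2) 4) G) (h6 : S.card = 6) {B₀ : Finset α}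
    (h₀ : B₀ ∈ opFarPre M G S) : (pairPre M 4 G S).card ≤ 7 := by
  have hSG : S ⊆ G := subset_of_mem_shadowAt hS
  have hX₀ : S \ B₀ = G \ clF M B₀ := sdiff_eq_of_mem_opFarPre h₀
  have hc₀ : (S \ B₀).card = 2 := by rw [hX₀]; exact (mem_opFarPre.1 h₀).2.1
  obtain ⟨a, b, hab, hXab⟩ := Finset.card_eq_two.1 hc₀
  have hp₀ : B₀ ∈ pairPre M 4 G S := opFarPre_subset_pairPre G S h₀
  have haX : a ∈ S \ B₀ := by rw [hXab]; simp
  have hbX : b ∈ S \ B₀ := by rw [hXab]; simp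
  have hy₀ := mem_of_mem_opFarPre hG hyG hyc h₀
  have hay : a ≠ y := fun h => (Finset.mem_sdiff.1 haX).2 (h ▸ hy₀)
  have hby : b ≠ y := fun h => (Finset.mem_sdiff.1 hbX).2 (h ▸ hy₀)
  have hcover : pairPre M 4 G S ⊆ (pairPre M 4 G S).filter (fun B => a ∈ S \ B) ∪
      (pairPre M 4 G S).filter (fun B => b ∈ S \ B) := by
    intro B hB
    obtain ⟨e, heX, hecl⟩ := Finset.not_subset.1 (not_sdiff_subset_clF_of_far hG hd hyG hyc h₀ hB)
    have heX₀ : e ∈ S \ B₀ := by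
      rw [hX₀, Finset.mem_sdiff]
      exact ⟨hSG (Finset.mem_sdiff.1 heX).1, hecl⟩
    rw [hXab, Finset.mem_insert, Finset.mem_singleton] at heX₀
    rw [Finset.mem_union, Finset.mem_filter, Finset.mem_filter]
    rcases heX₀ with rfl | rfl
    · exact Or.inl ⟨hB, heX⟩
    · exact Or.inr ⟨hB, heX⟩
  have ha := card_pairPre_filter_mem_le hG hyG hyc hS (Finset.mem_sdiff.1 haX).1 hay
  have hb := card_pairPre_filter_mem_le hG hyG hyc hS (Finset.mem_sdiff.1 hbX).1 hby
  have hinter : 1 ≤ ((pairPre M 4 G S).filter (fun B => a ∈ S \ B) ∩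
      (pairPre M 4 G S).filter (fun B => b ∈ S \ B)).card :=
    Finset.card_pos.2 ⟨B₀, Finset.mem_inter.2 ⟨Finset.mem_filter.2 ⟨hp₀, haX⟩, Finset.mem_filter.2 ⟨hp₀, hbX⟩⟩⟩
  have hu := Finset.card_union_add_card_inter ((pairPre M 4 G S).filter (fun B => a ∈ S \ B))
    ((pairPre M 4 G S).filter (fun B => b ∈ S \ B))
  have hle := Finset.card_le_card hcover
  omega

end PercRepro.Shadow
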